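import Summits.FinalStateConjecture.FinalStateConjecture.Theses.PhotonSphereChannels
import Summits.FinalStateConjecture.FinalStateConjecture.Theorems.PhotonSphereChannelsExteriorEnergyRW
import Summits.FinalStateConjecture.FinalStateConjecture.Theorems.PhotonSphereChannelsUniformPhotonSphereChannelsNearKernelCensus
import Literature.Geometry.Lorentzian.ReggeWheelerTortoise
import Literature.Geometry.Lorentzian.ReggeWheelerChannels

/-!
# Line `kruskal-rest-frame-virial` — skeleton for crux `PhotonSphereChannels.UniformPhotonSphereChannels`
# (K1, item stmt-FinalStateConjecture-10045, route-FinalStateConjecture-PhotonSphereChannels) — a NEGATIVE line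

**Direction.** The line DECIDES THE CRUX NEGATIVELY: its composition is the sorry-free theorem
`not_UniformPhotonSphereChannels : ¬ UniformPhotonSphereChannels` (§2), proved from six registered stubs
(§1).  K1 as typed (`∃ ρ₀(M) ∃ c(M) ∀ ℓ ∀ ρ ≥ ρ₀`) is refuted on paper by five independent seats (item
evidence: rreview `K1-evidence.md`, cdisprove `Disproof.lean`, prover seat 1, crux ideators 1–3, triage ×3,
four independent toy codes); this file is the Lean-sized plan of that refutation along the
`kruskal-rest-frame-virial` idea (ideator 2; merged by the triage panel with its twin
`rindler-boost-flux-disproof`, ideator 3).  When the stubs land, the composition lands as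
`Theorems/PhotonSphereChannelsUniformPhotonSphereChannelsRefutation.lean` (`theorem not_UniformPhotonSphereChannels`),
closing the item `refuted` and sending the route to its declared repair (`ρ₀(ℓ) = O(M log ℓ)` / horizon-flux
near end).  AUDIT NOTE: `lean check`'s file audit classifies the composition `refutes` → target
`…Theses.PhotonSphereChannels.UniformPhotonSphereChannels` BY NAME; `#h21_check_skeleton` selects candidates by a
POSITIVE head only, so register with
`ledger skeleton check <file> --crux stmt-FinalStateConjecture-10045 --crux-decl Summit.FinalStateConjecture.FinalStateConjecture.Cruxes.UniformPhotonSphereChannels.KruskalRestFrameVirial.NotUniformPhotonSphereChannels`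
(the by-name alias `NotUniformPhotonSphereChannels := ¬ UniformPhotonSphereChannels` of §2; verdict ok, 6 stubs).

**Idea (one paragraph).** Write `a = 1/4M` (surface gravity) and pull the horizon-side Regge–Wheeler
equation back to the Kruskal/Rindler frame `T = 4M e^{(x−xc)/4M} sinh(t/4M)`, `X = 4M e^{(x−xc)/4M} cosh(t/4M)`:
EXACTLY `φ_TT − φ_XX + W φ = 0` on the open wedge `{|T| < X}` with the horizon-regular mass
`W = μ(x) = e^{−(x−xc)/2M} V_{1,ℓ}(r(x)) = m²(1 + O(θ))`, `m² = ℓ(ℓ+1)e^{1/2}/(8M²)`, `θ = e^{(x−xc)/2M}`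
(Stubs 4, 5).  The near channel `{x < xe − t}` is `{T + X < ρe}`, `ρe = 4M e^{(xe−xc)/4M}`; its `t → +∞` end is the
HALF-horizon `{T = X < ρe/2}` (the refuters' lag constant `4M ln 2` is the midpoint law `V_cross = 2X₁`).  Take ODD
rest data `(0, g)`, `g` a `C²` bump at tortoise depth `0.4M … 0.8M` below the near edge, i.e. Kruskal positions
`X ∈ [e^{−1/5}ρe, e^{−1/10}ρe] = [0.82ρe, 0.90ρe]`: because `0.82 > 2/3`, up to Kruskal time `T' = 0.39ρe` the
packet's causal future stays at distance `≥ 0.038ρe` from the horizon, so EVERYTHING happens inside the open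
wedge (no horizon regularity, no Kruskal extension, no constant-mass model + Duhamel).  For late tortoise times
the energy-carrying part of the slice `t = t₀` lies above `T'`, and exact boost-current conservation + dominant
energy give `E_near(t₀) ≤ aρe · E_T(T'; X < ρe − T')`; the flat conservation laws of the `T`-frame
(energy; commuted energy `E_T[∂_Xφ]` / second moment; `‖φ‖² ≤ 2E/m²`), with an explicit `O(θ)` budget for the
variable mass and an `O(1/(mρe))` budget for dispersion, make `E_T(T'; X < 0.61ρe)` an arbitrarily small
fraction of `E_T(0)` once `xe → −∞` and then `ℓ → ∞` — this is Stub 6 (load-bearing).  Exterior-energy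
monotonicity (Stub 2) turns that into bounds on both channel energies; the near-side kernel census (Stub 3:
a `t`-polynomial kernel element with finite near kinetic energy has ZERO velocity trace — the 1-dimensional
static kernel) makes `dist²(data, P(ρ)) ≥ ∫ g²`; with the global solution from Stub 1 this contradicts
`c > 0` at `M = 1, xc = 0, s = 1, r = tortoiseRadius`, `ρ = −xe ≥ ρ₀`.  Parameter path: `xe ≤ x₀(c)` (θ small),
then `ℓ ≥ ℓ₀(g)` (mρe large) — legal because K1 grants every `ρ ≥ ρ₀` and every `ℓ`.

**Shape (lead's reshape v2, 2026-08-16T01:30Z — see the `LEAD RESHAPE v2` block in §1).** Three stubs: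
`stub_rwCauchyC3` (S–M: time-primitive of the landed even `C³` solution), `stub_nearKernelCensus` (LANDED p73053),
`stub_restPacketEscape` (L, held by the lead: assembly over the landed `Negative/*` Rindler tool-kit); the planner's
Stub 2 is the landed `Theorems.RW.exteriorEnergy_antitoneOn_rw`, Stubs 4–5 are off the proof path.  Everything else is
proved: the vocabulary bridge `channelInequality_of_uniform` (K1's inlined `let`s ARE
`ReggeWheeler.{linePotential, energyDensity, exteriorCone, rwKernel, kernelDeficit, channelEnergy}`, by `rfl`),
the profile `exists_restPacketProfile`, `deficit_lower_bound` (Stub 3 ⇒ coercive side, incl. the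
infinite-kinetic-energy case), `channelEnergy_le_of_antitone`, and the composition.  Stubs 4 and 5 enter the
composition as the two displayed hypotheses of Stub 6 (so a mis-cut dictionary fails to typecheck here, not in
a prover's session).  Stub statements mention only Mathlib, the route decl and
`Literature.Geometry.Lorentzian.ReggeWheeler*` (no local definitions), so each lands stand-alone with
`propose --supports stmt-FinalStateConjecture-10045`.

**Disproof used** (`Cruxes/UniformPhotonSphereChannels/Disproof.lean`, cdisprove cycle 1; read 2026-08-15).
There is no `_false_without_<H>` theorem (the disprover's own verdict is `refuted-substantive`; its near-miss
`Disproof.not_uniformPhotonSphereChannels` is sorried) — this skeleton IS the plan for that near-miss: its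
docstring's needs (i) C² well-posedness = Stub 1, (ii) finite speed / cone monotonicity = Stubs 1–2, (iv) ODE
kernel classification = Stub 3, while (iii) "quantitative Gaussian beam / WKB with turning point" is REPLACED by
the exact Kruskal dictionary + flat conservation laws (Stubs 4–6) — the point of this line.  Honoured:
`tortoise_hypotheses_satisfiable` (non-vacuity; here `ReggeWheeler.isTortoiseRadius_tortoiseRadius`),
`leftExteriorChannels_of_uniform` (the composition only ever uses the LEFT exterior: the same six stubs prove
`¬ Disproof.LeftExteriorChannels` verbatim — not imported here to keep the skeleton free of the sorried module),
`fixedModeChannels_of_uniform` (the witness family has `ℓ → ∞` at each ball, so it misses `FixedModeChannels`,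
as the disprover records), `uniformPhotonSphereChannelsNonnegConstant_trivial` (we use `c > 0` essentially: the
contradiction is `c·E₀ ≤ c·E₀/2`).  No `Negative/` lemma has landed (`ledger negatives` = 0): nothing to import.
-/

set_option linter.dupNamespace false

namespace Summit.FinalStateConjecture.FinalStateConjecture.Cruxes.UniformPhotonSphereChannels.KruskalRestFrameVirial

open Literature.Geometry.Lorentzian.ReggeWheeler
open Summit.FinalStateConjecture.FinalStateConjecture.Theses.PhotonSphereChannels
open MeasureTheory Filter Set
open scoped ENNReal Topology

/-! ## 0. The crux in the tree's Regge–Wheeler vocabulary (proved glue) -/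

/-- K1 read over `Literature.Geometry.Lorentzian.ReggeWheeler`: tortoise hypotheses = `IsTortoiseRadius`,
conclusion = `ChannelInequality (linePotential M s ℓ r) xc ρ c` (the inlined `let`s of the route decl are
these definitions verbatim). -/
theorem channelInequality_of_uniform (h : UniformPhotonSphereChannels) {M : ℝ} (hM : 0 < M) :
    ∃ ρ₀ : ℝ, 0 ≤ ρ₀ ∧ ∃ c : ℝ, 0 < c ∧ ∀ (r : ℝ → ℝ) (xc : ℝ), IsTortoiseRadius M r xc →
      ∀ s ℓ : ℕ, s ≤ 2 → s ≤ ℓ → ∀ ρ : ℝ, ρ₀ ≤ ρ →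
        ChannelInequality (linePotential M s ℓ r) xc ρ c := by
  obtain ⟨ρ₀, hρ₀, c, hc, H⟩ := h M hM
  refine ⟨ρ₀, hρ₀, c, hc, fun r xc hr s ℓ hs hsℓ ρ hρ φ hφ => ?_⟩
  exact H r xc hr.two_mul_lt hr.hasDerivAt hr.center s ℓ hs hsℓ ρ hρ φ hφ.1 hφ.2

/-! ## 1. The six stubs -/

/-! ### LEAD RESHAPE v2 (2026-08-16T01:30Z)

Between 00:05 and 01:08 the standing disprover (cdisprove gen 2) landed, under
`Theorems/UniformPhotonSphereChannels/Negative/`, the whole Rindler-frame tool-kit this line needs: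
`WaveDefect.rindler_solution` / `exists_logMod` (the conformal composite with a globally smooth
modification of `κ⁻¹log(κ·)` is a GLOBAL `C³` solution of `u_TT − u_XX + Wu = 0`),
`RWNear.W_bounds` / `W_fderiv_bounds` (mass bounds and slow variation of `W` on the Rindler chart),
`WaveDefect.pinning_bound` (rest-packet pinning, needs `u ∈ C³`), `WaveDefect.ray_flux_le` (energy flux
through the tortoise slice `T = βX`), `WaveDefect.rw_energy_slice_le` (RW energy of the slice ≤ that
flux), `WaveDefect.energy_le_two_mul` (approximate conservation), and `Blindness.exists_even_solution_C3`.
Consequently the planner's Stub 4 (`stub_kruskalPullback`, wedge form) and Stub 5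
(`stub_horizonRegularMass`, two-term asymptotics) are no longer on the proof path and are DROPPED;
Stub 1 is upgraded to `C³` (`stub_rwCauchyC3`: the pinning commutes the equation with `∂_X`);
Stub 6 (`stub_restPacketEscape`) is restated self-contained (no displayed hypotheses), at `xc = 0`
(what the composition uses and what the `RWNear` lemmas are stated for), with the packet's support
interval chosen BY the stub, and with the conclusion at the two times `±T₁` (the landed monotonicity
does the rest).  Registered stubs: `stub_rwCauchyC3`, `stub_nearKernelCensus` (LANDED p73053),
`stub_restPacketEscape`.
-/

/-- **Stub 1 (v2) — the `1+1` Cauchy problem for Regge–Wheeler with ODD, compactly supported `C³`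
data: a global `C³` solution with light-cone support.**  For a tortoise radius function `r` (so
`V = V_{s,ℓ}∘r` is `C^∞`, bounded, `≥ 0` for `ℓ ≥ s`) and `g ∈ C³` vanishing off `(α, β)`, there is a
GLOBAL classical solution `ψ ∈ C³(ℝ²)` of `ψ_tt − ψ_xx + Vψ = 0` with `ψ(0,·) = 0`, `ψ_t(0,·) = g`,
supported in `{α − |t| ≤ x ≤ β + |t|}`.  Why true / how (S–M given the tree): take the EVEN `C³` solution
`ψe` with data `(g, 0)` — `Blindness.exists_even_solution_C3` (`Negative/CauchyC3.lean`: `V ∈ C²`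
bounded, `A ∈ C³` vanishing off `Icc α β`) with `V := linePotential M s ℓ r` (`C^∞` by
`Theorems.tortoise_contDiff`, `|V| ≤ (ℓ(ℓ+1)+1)/(2M)²` by `CauchyWave.abs_linePotential_le`) — and set
`ψ(t,x) := ∫ s in 0..t, ψe s x`.  Then `ψ ∈ C³` (`WaveEnergy.contDiff_parametric_primitive_nat 3`,
`PhotonSphereChannelsParametricPrimitive.lean`), `ψ_t = ψe`, `ψ_tt = ∂_tψe`,
`ψ_xx = ∫₀ᵗ ∂ₓ²ψe = ∫₀ᵗ (∂_s²ψe + Vψe) = ∂_tψe(t,·) − ∂_tψe(0,·) + Vψ = ∂_tψe + Vψ` (the even datum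
`∂_tψe(0,·) = 0`), so the equation holds; `ψ(0,·) = 0`, `ψ_t(0,·) = ψe(0,·) = g`; the support is that
of `ψe` (closed form by continuity, cf. `CauchyWave.eq_zero_of_closed_support`).  The `C²` version with
this exact shape is LANDED (`CauchyWave.stub_rwCauchy`, p71897). [folklore] -/
theorem stub_rwCauchyC3 {M : ℝ} {r : ℝ → ℝ} {xc : ℝ} (hr : IsTortoiseRadius M r xc)
    (s ℓ : ℕ) (hsℓ : s ≤ ℓ) (g : ℝ → ℝ) (hg : ContDiff ℝ 3 g) (α β : ℝ)
    (hsupp : ∀ x, x ≤ α ∨ β ≤ x → g x = 0) :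
    ∃ ψ : ℝ → ℝ → ℝ, IsRWSolution M s ℓ r ψ ∧ ContDiff ℝ 3 (Function.uncurry ψ) ∧
      (∀ x, ψ 0 x = 0) ∧ (∀ x, deriv (fun τ => ψ τ x) 0 = g x) ∧
      ∀ t x, (x + |t| ≤ α ∨ β + |t| ≤ x) → ψ t x = 0 := by
  sorry

/-! **Stub 3 (`stub_nearKernelCensus`) is LANDED** (wave 1, p73053:
`Theorems/PhotonSphereChannelsUniformPhotonSphereChannelsNearKernelCensus.lean`, decl
`Summit.FinalStateConjecture.FinalStateConjecture.Theorems.KruskalRestFrameVirial.stub_nearKernelCensus`, the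
registered signature verbatim: a kernel element with finite near ENERGY at `t = 0` has zero velocity trace on
the near half-line — adapter on `KernelCensus.static_of_finite_energy`).  Imported above and used by the
composition through `deficit_lower_bound`. -/

/-- **Stub 6 (v2, load-bearing; the line's engine) — odd rest packets parked just below the near
edge escape BOTH near channels.**  Photon sphere at the origin (`IsTortoiseRadius M r 0`), near edge
`xe`, ball `ρ = −xe`.  For every `ε > 0` there is a depth threshold `x₀` such that for every near edge
`xe ≤ x₀` there is a support window `[a, b]`, `a < b ≤ xe` (the stub's choice: tortoise depth between
`4M log(5/4)` and `4M log(10/9)` below `xe`, i.e. Rindler positions `X ∈ [4ρe/5, 9ρe/10]`,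
`ρe = 4M e^{xe/4M}`), such that for every `C³` profile `g` supported in `[a, b]` there is `ℓ₀` beyond
which EVERY global `C³` solution `ψ` of the spin-1 Regge–Wheeler equation with data `(0, g)` and
light-cone support has, at some time `T₁ ≥ 0` and at `−T₁`, two-ended exterior energy
`E_ext(±T₁) ≤ ε ∫ g²` (the far half-line carries nothing by support since `b ≤ xe ≤ 0 ≤ −xe`).
Why true / how (assembly over the LANDED `Negative/*` tool-kit, xc = 0, κ = 1/4M, β = 4/5,
`t₁ = T₁… = 2M log 9` in tortoise time, Rindler times `T_lo = 3ρe/10` (pinning), `T_hi = 4ρe/9`,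
ray `X ∈ [3ρe/8, 5ρe/9]`, wedge margin `m₀ = 3ρe/40`, chart floor `A₀ = ρe/20`, cut-off `χ = 1` on
`(−∞, 7ρe/10]`, `= 0` on `[3ρe/4, ∞)`):  `u := ψ ∘ S` with `α` from `WaveDefect.exists_logMod` is a global
`C³` solution of `u_TT − u_XX + Wu = 0` vanishing on `{X + |T| < 4ρe/5}` and `{9ρe/10 < X − |T|}`
(odd twin of `WaveDefect.rindler_solution`: `contDiff_conformal`, `wave_conformal`, `fderiv_conformal`),
with `u(0,·) = 0`, `u_T(0,X) = g(αX)/(κX)`; `RWNear.W_bounds/W_fderiv_bounds` give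
`W ≥ ℓ(ℓ+1)/27M²`, `|∂W| ≤ D = O(ℓ² ρe/M⁴)` on the influence regions (all inside `{X ≤ 4M}` once
`ρe ≤ M/2`), so `T_lo D ≤ W_min/4` iff `(ρe/M)² ≲ 0.27`: this fixes `x₀(ε, M)`; then
`E_near^{RW}(t₁) ≤ 2κX₂·Flux` (`rw_energy_slice_le`) `≤ 2κX₂[∫χe(T_lo) + 4(D/W_min)(T_hi−T_lo)·2E(0)]`
(`ray_flux_le`, `energy_le_two_mul`) and `∫χe(T_lo) ≤ T_lo[(D/W_min + C_χλ)2E(0) +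
(C_χ/(λW_min))(2E₁(0) + 16T_lo²D²E(0)/W_min)]` (`pinning_bound`) with `E(0) = ∫_a^b g² e^{−κx} ≤
(5M/ρe)∫g²`, `2κX₂E(0) ≤ (25/18)∫g²`, `E₁(0) = ∫ G'²` INDEPENDENT of `ℓ`; choose
`λ = ε/(28 T_lo C_χ)` and then `ℓ₀(ε, xe, g)` so that the `1/W_min` terms are `≤ ε∫g²/4` (case `∫g² = 0`:
`g ≡ 0`, `ψ ≡ 0` by finite speed).  Negative time: apply the `+T₁` statement to `(t,x) ↦ −ψ(−t,x)`, which
has the same data, regularity and support.  Lower integrals ↔ interval integrals by continuity and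
compact support (`Literature.Analysis.PDE.lintegral_Ioc_wave1D_energy_eq`). Size L (bookkeeping only).
[new on this problem; mechanism = `Literature.Barriers.FinalStateConjecture.KleinGordonSuperradiantInstability`'s
"CoE fails for □ − μ²", transported to the horizon by the Rindler dictionary] -/
theorem stub_restPacketEscape {M : ℝ} {r : ℝ → ℝ} (hr : IsTortoiseRadius M r 0)
    (ε : ℝ) (hε : 0 < ε) :
    ∃ x₀ : ℝ, ∀ xe : ℝ, xe ≤ x₀ → ∃ a b : ℝ, a < b ∧ b ≤ xe ∧
      ∀ g : ℝ → ℝ, ContDiff ℝ 3 g → (∀ x, x ≤ a ∨ b ≤ x → g x = 0) →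
      ∃ ℓ₀ : ℕ, ∀ ℓ : ℕ, ℓ₀ ≤ ℓ → ∀ ψ : ℝ → ℝ → ℝ,
        IsRWSolution M 1 ℓ r ψ → ContDiff ℝ 3 (Function.uncurry ψ) →
        (∀ x, ψ 0 x = 0) → (∀ x, deriv (fun τ => ψ τ x) 0 = g x) →
        (∀ t x, (x + |t| ≤ a ∨ b + |t| ≤ x) → ψ t x = 0) →
        ∃ T₁ : ℝ, 0 ≤ T₁ ∧
          exteriorEnergy (linePotential M 1 ℓ r) 0 (-xe) ψ T₁ ≤ ENNReal.ofReal (ε * ∫ x, g x ^ 2) ∧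
          exteriorEnergy (linePotential M 1 ℓ r) 0 (-xe) ψ (-T₁) ≤ ENNReal.ofReal (ε * ∫ x, g x ^ 2) := by
  sorry

/-! ## 2. Glue (proved) -/

/-- A by-name handle on the decided statement: the line REFUTES the crux (`¬ K1`).  Needed only because
`ledger skeleton check` selects the composing theorem by the HEAD CONSTANT of its conclusion; pass
`--crux-decl Summit.FinalStateConjecture.FinalStateConjecture.Cruxes.UniformPhotonSphereChannels.KruskalRestFrameVirial.NotUniformPhotonSphereChannels`.
The `lean check` file audit classifies `not_UniformPhotonSphereChannels` below as `refutes` → target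
`…Theses.PhotonSphereChannels.UniformPhotonSphereChannels` (by name). -/
def NotUniformPhotonSphereChannels : Prop := ¬ UniformPhotonSphereChannels

/-- The data profile of the witness family: a `C³` bump supported in a given window `[a, b]`,
`a < b`, with positive `L²` mass. -/
theorem exists_restPacketProfile {a b : ℝ} (hab : a < b) :
    ∃ g : ℝ → ℝ, ContDiff ℝ 3 g ∧ (∀ x, x ≤ a ∨ b ≤ x → g x = 0) ∧
      Integrable (fun x => g x ^ 2) ∧ 0 < ∫ x, g x ^ 2 := by
  let g : ℝ → ℝ := fun x => expNegInvGlue (x - a) * expNegInvGlue (b - x)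
  have hg_def : ∀ x, g x = expNegInvGlue (x - a) * expNegInvGlue (b - x) := fun x => rfl
  have hg0 : ∀ x, x ≤ a ∨ b ≤ x → g x = 0 := by
    intro x hx
    rcases hx with h | h
    · rw [hg_def, expNegInvGlue.zero_of_nonpos (by linarith), zero_mul]
    · rw [hg_def, expNegInvGlue.zero_of_nonpos (by linarith : b - x ≤ 0), mul_zero]
  have hgc : ContDiff ℝ 3 g :=
    ((expNegInvGlue.contDiff (n := 3)).comp (contDiff_id.sub contDiff_const)).mul
      ((expNegInvGlue.contDiff (n := 3)).comp (contDiff_const.sub contDiff_id))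
  have hgcont : Continuous g := hgc.continuous
  have hint : Integrable (fun x => g x ^ 2) := by
    refine (hgcont.pow 2).integrable_of_hasCompactSupport ?_
    refine HasCompactSupport.intro (isCompact_Icc (a := a) (b := b)) fun x hx => ?_
    have : g x = 0 := by
      apply hg0
      by_contra hcon
      simp only [not_or, not_le] at hcon
      exact hx ⟨hcon.1.le, hcon.2.le⟩
    simp [this]
  refine ⟨g, hgc, hg0, hint, ?_⟩
  refine (integral_pos_iff_support_of_nonneg (fun x => sq_nonneg (g x)) hint).2 ?_
  have hsub : Ioo a b ⊆ Function.support fun x => g x ^ 2 := by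
    intro x hx
    have h1 : 0 < expNegInvGlue (x - a) := expNegInvGlue.pos_of_pos (by linarith [hx.1])
    have h2 : 0 < expNegInvGlue (b - x) := expNegInvGlue.pos_of_pos (by linarith [hx.2])
    simp only [Function.mem_support, hg_def]
    positivity
  refine lt_of_lt_of_le ?_ (measure_mono hsub)
  rw [Real.volume_Ioo]
  exact ENNReal.ofReal_pos.2 (by linarith)

/-- From the census (Stub 3) to the coercive side: for ODD data `(0, g)` with `g` supported on the near
side, `dist²(data, P(ρ)) ≥ ∫ g²` — for a kernel element `p`, either the near energy of `ψ − p` at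
`t = 0` is infinite, or (as `ψ(0,·) = 0`) `p` itself has finite near energy, hence zero velocity trace
on the near half-line (census), and then `e[ψ − p](0,x) ≥ g(x)²` there. -/
theorem deficit_lower_bound {M : ℝ} {r : ℝ → ℝ} {xc : ℝ} (hr : IsTortoiseRadius M r xc) (ℓ : ℕ)
    (hℓ : 1 ≤ ℓ) (ρ : ℝ) (ψ : ℝ → ℝ → ℝ) (hψ : ContDiff ℝ 2 (Function.uncurry ψ))
    (hψ0 : ∀ x, ψ 0 x = 0)
    (g : ℝ → ℝ) (hg : Continuous g) (hψt : ∀ x, deriv (fun τ => ψ τ x) 0 = g x)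
    (hg0 : ∀ x, xc - ρ ≤ x → g x = 0) (hgi : Integrable (fun x => g x ^ 2))
    (hcensus : ∀ p ∈ rwKernel (linePotential M 1 ℓ r) xc ρ,
      ∫⁻ x in Iio (xc - ρ), ENNReal.ofReal (energyDensity (linePotential M 1 ℓ r) p 0 x) < ∞ →
        ∀ x, x < xc - ρ → deriv (fun τ => p τ x) 0 = 0) :
    ENNReal.ofReal (∫ x, g x ^ 2) ≤ kernelDeficit (linePotential M 1 ℓ r) xc ρ ψ := by
  set V := linePotential M 1 ℓ r with hV
  have hV0 : ∀ x, 0 ≤ V x := fun x => linePotential_nonneg hr.mass_pos.le hℓ hr.two_mul_lt x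
  -- the data integral as a lower integral over the near half-line
  have hG : ENNReal.ofReal (∫ x, g x ^ 2) = ∫⁻ x in Iio (xc - ρ), ENNReal.ofReal (g x ^ 2) := by
    rw [ofReal_integral_eq_lintegral_ofReal hgi (ae_of_all _ fun x => sq_nonneg (g x)),
      ← lintegral_add_compl (fun x => ENNReal.ofReal (g x ^ 2)) (measurableSet_Iio (a := xc - ρ)),
      setLIntegral_eq_zero (measurableSet_Iio (a := xc - ρ)).compl, add_zero]
    intro x hx
    simp only [mem_compl_iff, mem_Iio, not_lt] at hx
    simp [hg0 x hx]
  have hGfin : ∫⁻ x in Iio (xc - ρ), ENNReal.ofReal (g x ^ 2) < ∞ := hG ▸ ENNReal.ofReal_lt_top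
  have hgm : Measurable fun x => ENNReal.ofReal (g x ^ 2) :=
    ENNReal.measurable_ofReal.comp (hg.pow 2).measurable
  -- slices of ψ are differentiable
  have hslice : ∀ x : ℝ, DifferentiableAt ℝ (fun τ : ℝ => (τ, x)) 0 := fun x => by fun_prop
  have hdψ : ∀ x, DifferentiableAt ℝ (fun τ => ψ τ x) 0 := fun x => by
    have h1 : DifferentiableAt ℝ (Function.uncurry ψ) ((fun τ : ℝ => (τ, x)) 0) :=
      (hψ.differentiable (by norm_num)) _
    exact h1.comp (0 : ℝ) (hslice x)
  have hψ0' : ψ 0 = fun _ => 0 := funext hψ0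
  unfold kernelDeficit
  refine le_iInf₂ fun p hp => ?_
  obtain ⟨hpC, hpS, hpP⟩ := hp
  -- slices of p are differentiable at t = 0 on the near half-line
  have hmem : ∀ x, x < xc - ρ → ((0 : ℝ), x) ∈ exteriorCone xc ρ := by
    intro x hx
    simp only [mem_exteriorCone, abs_zero, add_zero]
    rw [abs_sub_comm]
    exact lt_of_lt_of_le (by linarith) (le_abs_self _)
  have hdp : ∀ x, x < xc - ρ → DifferentiableAt ℝ (fun τ => p τ x) 0 := fun x hx => by
    have h1 : DifferentiableAt ℝ (Function.uncurry p) ((fun τ : ℝ => (τ, x)) 0) :=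
      (hpC.contDiffAt ((isOpen_exteriorCone xc ρ).mem_nhds (hmem x hx))).differentiableAt
        (by norm_num)
    exact h1.comp (0 : ℝ) (hslice x)
  set q : ℝ → ℝ := fun x => deriv (fun τ => p τ x) 0 with hq
  have hderiv : ∀ x, x < xc - ρ → deriv (fun τ => ψ τ x - p τ x) 0 = g x - q x := by
    intro x hx
    rw [← hψt x]
    exact deriv_sub (hdψ x) (hdp x hx)
  -- pointwise: the energy density of ψ − p at t = 0 on the near half-line
  have hpt : ∀ x, x < xc - ρ →
      energyDensity V (fun t y => ψ t y - p t y) 0 x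
        = (g x - q x) ^ 2 + deriv (p 0) x ^ 2 + V x * p 0 x ^ 2 := by
    intro x hx
    unfold energyDensity
    rw [hderiv x hx]
    have h2 : (fun t y => ψ t y - p t y) 0 = fun y => -p 0 y := by
      funext y
      simp [hψ0 y]
    rw [h2, deriv.fun_neg]
    ring
  set E := ∫⁻ x in Iio (xc - ρ), ENNReal.ofReal (energyDensity V (fun t y => ψ t y - p t y) 0 x)
    with hE
  have hsub : Iio (xc - ρ) ⊆ {x : ℝ | ρ < |x - xc|} := by
    intro x hx
    simp only [mem_Iio] at hx
    simp only [mem_setOf_eq]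
    rw [abs_sub_comm]
    exact lt_of_lt_of_le (by linarith) (le_abs_self _)
  refine le_trans ?_ (lintegral_mono_set hsub)
  rw [hG]
  change ∫⁻ x in Iio (xc - ρ), ENNReal.ofReal (g x ^ 2) ≤ E
  by_cases hEtop : E = ∞
  · rw [hEtop]; exact le_top
  · -- finite near energy of ψ − p ⇒ finite near energy of p itself (ψ(0,·) = 0, g ∈ L²)
    have hElt : E < ∞ := lt_top_iff_ne_top.2 hEtop
    have hptP : ∀ x ∈ Iio (xc - ρ), ENNReal.ofReal (energyDensity V p 0 x) ≤
        2 * ENNReal.ofReal (energyDensity V (fun t y => ψ t y - p t y) 0 x)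
          + 2 * ENNReal.ofReal (g x ^ 2) := by
      intro x hx
      have h2 : (2 : ℝ≥0∞) = ENNReal.ofReal 2 := by simp
      have hVp : 0 ≤ V x * p 0 x ^ 2 := mul_nonneg (hV0 x) (sq_nonneg _)
      have hA : 0 ≤ 2 * ((g x - q x) ^ 2 + deriv (p 0) x ^ 2 + V x * p 0 x ^ 2) := by positivity
      have hB : 0 ≤ 2 * g x ^ 2 := by positivity
      rw [hpt x hx, h2, ← ENNReal.ofReal_mul zero_le_two, ← ENNReal.ofReal_mul zero_le_two,
        ← ENNReal.ofReal_add hA hB]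
      refine ENNReal.ofReal_le_ofReal ?_
      unfold energyDensity
      nlinarith [sq_nonneg (g x - q x + g x), sq_nonneg (2 * g x - q x), sq_nonneg (deriv (p 0) x),
        sq_nonneg (q x - 2 * g x), hVp]
    have hfinP : ∫⁻ x in Iio (xc - ρ), ENNReal.ofReal (energyDensity V p 0 x) < ∞ := by
      calc ∫⁻ x in Iio (xc - ρ), ENNReal.ofReal (energyDensity V p 0 x)
          ≤ ∫⁻ x in Iio (xc - ρ), (2 * ENNReal.ofReal (energyDensity V (fun t y => ψ t y - p t y) 0 x)
              + 2 * ENNReal.ofReal (g x ^ 2)) := setLIntegral_mono' measurableSet_Iio hptP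
        _ = 2 * E + 2 * ∫⁻ x in Iio (xc - ρ), ENNReal.ofReal (g x ^ 2) := by
            rw [lintegral_add_right _ (hgm.const_mul 2), lintegral_const_mul' _ _ ENNReal.ofNat_ne_top,
              lintegral_const_mul' _ _ ENNReal.ofNat_ne_top]
        _ < ∞ := ENNReal.add_lt_top.2 ⟨ENNReal.mul_lt_top (by simp) hElt,
            ENNReal.mul_lt_top (by simp) hGfin⟩
    -- census: the velocity trace of p vanishes on the near half-line
    have hq0 : ∀ x, x < xc - ρ → q x = 0 := hcensus p ⟨hpC, hpS, hpP⟩ hfinP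
    refine setLIntegral_mono' measurableSet_Iio fun x hx => ?_
    simp only [mem_Iio] at hx
    rw [hpt x hx, hq0 x hx, sub_zero]
    refine ENNReal.ofReal_le_ofReal ?_
    nlinarith [sq_nonneg (deriv (p 0) x), mul_nonneg (hV0 x) (sq_nonneg (p 0 x))]

/-- Channel energies are dominated by the exterior energy at any time beyond which the exterior
energy is monotone (Stub 2 ⇒ `liminf ≤` value). -/
theorem channelEnergy_le_of_antitone {V : ℝ → ℝ} {xc ρ : ℝ} {ψ : ℝ → ℝ → ℝ}
    (h : AntitoneOn (exteriorEnergy V xc ρ ψ) (Ici 0) ∧ MonotoneOn (exteriorEnergy V xc ρ ψ) (Iic 0))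
    {t₁ : ℝ} (ht₁ : 0 ≤ t₁) :
    channelEnergy V xc ρ ψ atTop ≤ exteriorEnergy V xc ρ ψ t₁ ∧
      channelEnergy V xc ρ ψ atBot ≤ exteriorEnergy V xc ρ ψ (-t₁) := by
  constructor
  · refine liminf_le_of_frequently_le' (Eventually.frequently ?_)
    filter_upwards [eventually_ge_atTop t₁] with t ht
    exact h.1 (mem_Ici.2 ht₁) (mem_Ici.2 (ht₁.trans ht)) ht
  · refine liminf_le_of_frequently_le' (Eventually.frequently ?_)
    filter_upwards [eventually_le_atBot (-t₁)] with t ht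
    exact h.2 (mem_Iic.2 (ht.trans (by linarith))) (mem_Iic.2 (by linarith)) ht

/-- **The line decides the crux negatively.**  Composition of the three stubs: fix `M = 1`,
`xc = 0`, `r = tortoiseRadius`, `s = 1`; take `ε = c/4`; put the near edge `xe` below both the stub's
depth threshold and `−ρ₀`; let the escape stub choose the support window `[a, b]`, `b ≤ xe`; take the
`C³` bump there and `ℓ ≥ ℓ₀`, `ℓ ≥ 1`; solve (Stub 1, `C³`); bound both channel energies by
`(c/4) ∫g²` (Stub 6 at `±T₁`, then the LANDED monotonicity `RW.exteriorEnergy_antitoneOn_rw`);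
bound the deficit below by `∫ g²` (Stub 3 through `deficit_lower_bound`); contradiction in `ℝ≥0∞`. -/
theorem not_UniformPhotonSphereChannels : ¬ UniformPhotonSphereChannels := by
  intro hK
  obtain ⟨ρ₀, hρ₀, c, hc, H⟩ := channelInequality_of_uniform hK one_pos
  set r : ℝ → ℝ := tortoiseRadius one_pos 0 with hr_def
  have hr : IsTortoiseRadius 1 r 0 := isTortoiseRadius_tortoiseRadius one_pos 0
  -- depth threshold from the escape stub
  obtain ⟨x₀, hx₀⟩ := stub_restPacketEscape hr (c / 4) (by positivity)
  -- near edge `xe`, ball radius `ρ = −xe ≥ ρ₀`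
  set xe : ℝ := min x₀ (-ρ₀) with hxe_def
  have hxe₀ : xe ≤ x₀ := min_le_left _ _
  have hxeρ : xe ≤ -ρ₀ := min_le_right _ _
  set ρ : ℝ := -xe with hρ_def
  have hρ₀ρ : ρ₀ ≤ ρ := by rw [hρ_def]; linarith
  have hρ0 : 0 ≤ ρ := hρ₀.trans hρ₀ρ
  -- the support window and the data profile
  obtain ⟨a, b, hab, hbxe, hwin⟩ := hx₀ xe hxe₀
  obtain ⟨g, hg3, hgsupp, hgint, hgpos⟩ := exists_restPacketProfile hab
  -- the angular-number threshold
  obtain ⟨ℓ₀, hℓ₀⟩ := hwin g hg3 hgsupp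
  set ℓ : ℕ := max ℓ₀ 1 with hℓ_def
  have hℓ1 : 1 ≤ ℓ := le_max_right _ _
  -- the global `C³` solution with data (0, g)
  obtain ⟨ψ, hψsol, hψ3, hψ0, hψt, hψsupp⟩ := stub_rwCauchyC3 hr 1 ℓ hℓ1 g hg3 a b hgsupp
  -- escape: exterior energies at ±T₁ are ≤ (c/4) ∫ g²
  obtain ⟨T₁, hT₁, hEp, hEm⟩ := hℓ₀ ℓ (le_max_left _ _) ψ hψsol hψ3 hψ0 hψt hψsupp
  -- K1 for this solution
  have hCI : ENNReal.ofReal c * kernelDeficit (linePotential 1 1 ℓ r) 0 ρ ψ ≤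
      channelEnergy (linePotential 1 1 ℓ r) 0 ρ ψ atTop +
        channelEnergy (linePotential 1 1 ℓ r) 0 ρ ψ atBot :=
    H r 0 hr 1 ℓ (by norm_num) hℓ1 ρ hρ₀ρ ψ hψsol
  -- upper bounds on the channel energies (LANDED monotonicity + Stub 6)
  have hmono := Theorems.RW.exteriorEnergy_antitoneOn_rw hr hℓ1 hψsol 0 hρ0
  obtain ⟨hup, hdown⟩ := channelEnergy_le_of_antitone hmono hT₁
  have hup' := hup.trans hEp
  have hdown' := hdown.trans hEm
  -- lower bound on the deficit (Stub 3)
  have hlow : ENNReal.ofReal (∫ x, g x ^ 2) ≤ kernelDeficit (linePotential 1 1 ℓ r) 0 ρ ψ :=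
    deficit_lower_bound hr ℓ hℓ1 ρ ψ hψsol.1 hψ0 g hg3.continuous hψt
      (fun x hx => hgsupp x (Or.inr (by rw [hρ_def] at hx; linarith))) hgint
      (fun p hp hfin => Theorems.KruskalRestFrameVirial.stub_nearKernelCensus hr 1 ℓ hℓ1 ρ p hp hfin)
  -- contradiction
  set E₀ : ℝ := ∫ x, g x ^ 2 with hE₀_def
  have key : ENNReal.ofReal (c * E₀) ≤ ENNReal.ofReal (c / 4 * E₀ + c / 4 * E₀) := by
    calc ENNReal.ofReal (c * E₀) = ENNReal.ofReal c * ENNReal.ofReal E₀ := ENNReal.ofReal_mul hc.le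
      _ ≤ ENNReal.ofReal c * kernelDeficit (linePotential 1 1 ℓ r) 0 ρ ψ := by gcongr
      _ ≤ _ := hCI
      _ ≤ ENNReal.ofReal (c / 4 * E₀) + ENNReal.ofReal (c / 4 * E₀) := add_le_add hup' hdown'
      _ = ENNReal.ofReal (c / 4 * E₀ + c / 4 * E₀) :=
          (ENNReal.ofReal_add (by positivity) (by positivity)).symm
  have key' := (ENNReal.ofReal_le_ofReal_iff (by positivity)).1 key
  nlinarith [mul_pos hc hgpos]

/-- By-name form for `ledger skeleton check --crux-decl …NotUniformPhotonSphereChannels`. -/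
theorem NotUniformPhotonSphereChannels_of : NotUniformPhotonSphereChannels :=
  not_UniformPhotonSphereChannels

end Summit.FinalStateConjecture.FinalStateConjecture.Cruxes.UniformPhotonSphereChannels.KruskalRestFrameVirial
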